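import Summits.BirchSwinnertonDyer.BirchSwinnertonDyer.Theorems.GoldfeldAllTwistsTwoConverseTwinGenusRankOneRat
import Summits.BirchSwinnertonDyer.BirchSwinnertonDyer.Theorems.GoldfeldAllTwistsTwoConverseTwinGenusTheoremAReduction
import Summits.BirchSwinnertonDyer.BirchSwinnertonDyer.Theorems.GoldfeldAllTwistsTwoConverseTwinGenusFieldDescent
import Mathlib.FieldTheory.Normal.Basic
import Literature.NumberTheory.EllipticCurves.QuadraticTwistPadicReduction
import HarnessLib

set_option linter.dupNamespace false
set_option autoImplicit false

/-!
# LINE B49, genus assembly (A), step W-A2 part II(a): the genus field `K(r₀) = K(i₀)` — descent of the genus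
# point `P_χ` and its anti-invariance under `Gal(K(i₀)/K)` (equivariance + `AlgHom.liftNormal`)

Cell `bsd-goldfeld`, seat `bsd-goldfeld-s1p-c3` (prover, gen 7); memo `HOME/GENUS-THEOREM-A.md` §2 (RO),
planner g16 ruling (xxxvi) (W-A2). Support for item `stmt-BirchSwinnertonDyer-19140` (crux twin″; joint with
20044 K12₂″). Clean cone. HONEST FRAMING: BSD is not proved by any of this; printed input: CLTZ 2015 Thm 1.2
(`h12`), via part I.

THE ARGUMENT (memo §2). `K` imaginary quadratic, `d_K = −4q`; `L/K` finite Galois (the Hilbert class field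
`K[1]`), `r₀ ∈ L` with `r₀² = q`, `y₁ ∈ X₀(49)(L)`; `P_χ = Σ_σ χ(σ)•σy₁`, `χ(σ) = ±1` as `σr₀ = ±r₀`. (1) `P_χ`
descends to `y_χ ∈ X₀(49)(H₀)`, `H₀ = K(r₀)` (gen 6, `exists_map_adjoin_eq_twistedSum`). (2) `H₀ = K(i₀)` with
`i₀ = δ r₀/(2q)`, `δ² = d_K`; the non-trivial `K`-automorphism `σ₀` of `H₀` (`Quadratic.conj`, `σ₀ i₀ = −i₀`,
`σ₀ r₀ = −r₀`) lifts to `τ ∈ Gal(L/K)` (`AlgHom.liftNormal`) with `χ(τ) = −1`, and `τ P_χ = −P_χ`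
(`map_twistedSum_eq_neg_of_apply_eq_neg`), so `σ₀ y_χ = −y_χ`. (3) On the completed-square model, `y_χ` is
therefore `τ_i(P)` for a `K`-point `P` of the twist by `−1` = the `784`-curve (tree `QuadraticDescent`,
`exists_twistMap_eq_of_conjMap_eq_neg` of part I) and `τ_i((0,1)) = (0, i₀)`. (4) Part I:
`(2n)•P − a•(0,1)` torsion with `n` odd; push through `τ_i`, the completing-square isomorphism and
`H₀ → L`. (5) `(0, i₀)` has infinite order by gen 6's `α`-descent (`cm7_not_isOfFinAddOrder_of_oddMultiple`).
Result: `exists_rankOne_oddIndex_twistedSum` (abstract `L`) and, at `L = K[1]`, `y₁ = d.y`, the hypothesis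
`hRO` of `x049GenusTheoremA_of_rankOne_of_heightRatio` (W-A1): `x049GenusTheoremA_hRO`.

References: J. Coates, Y. Li, Y. Tian, S. Zhai, PLMS 110 (2015) Thm 1.2, (2.8) [CoatesLiTianZhai2015]; J. H.
Silverman, AEC (2009) X.2, Ex. 10.16 [SilvermanAEC2009]; B. Gross (1984) §§4–5 [Gross1984].
-/

noncomputable section

open scoped Classical IntermediateField

open WeierstrassCurve Literature.NumberTheory.EllipticCurves
  Literature.NumberTheory.EllipticCurves.ModularForms

namespace Summit.BirchSwinnertonDyer.BirchSwinnertonDyer.Theorems.GoldfeldGoodTwists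

/-! ## §1 Equivariance: an automorphism negating `r₀` negates the twisted sum -/

section Equivariance

variable {k : Type*} {L : Type*} [Field k] [CharZero k] [Field L] [CharZero L] [Algebra k L]
  (W : WeierstrassCurve ℚ)

omit [CharZero k] [CharZero L] in
/-- If `τ r₀ = −r₀` (and `r₀ ≠ 0`) then `(τσ) r₀ = r₀ ↔ σ r₀ ≠ r₀`, for `r₀² = d ∈ k`. [folklore] -/
theorem mul_apply_sqrt_eq_iff_of_neg (τ σ : L ≃ₐ[k] L) {r₀ : L} {d : k} (hr : r₀ ^ 2 = algebraMap k L d)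
    (hr0 : r₀ ≠ 0) (h2 : (2 : L) ≠ 0) (hτ : τ r₀ = -r₀) : (τ * σ) r₀ = r₀ ↔ ¬ σ r₀ = r₀ := by
  have hne : -r₀ ≠ r₀ := fun h ↦ hr0 (by
    have : (2 : L) * r₀ = 0 := by linear_combination -h
    exact (mul_eq_zero.mp this).resolve_left h2)
  rw [AlgEquiv.mul_apply]
  rcases apply_sqrt_eq_self_or_neg σ hr with h | h
  · rw [h, hτ]; simpa using hne
  · rw [h, map_neg, hτ, neg_neg]; exact ⟨fun _ => hne, fun _ => rfl⟩

/-- **`τ(Σ_σ ε(σ)•σy) = −Σ_σ ε(σ)•σy` when `τ r₀ = −r₀`**, for the quadratic cutout weight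
`ε(σ) = [σ r₀ = r₀] ? 1 : −1` (reindex by `σ ↦ τσ`; `ε(τσ) = −ε(σ)`). [folklore] -/
theorem map_twistedSum_eq_neg_of_apply_eq_neg [FiniteDimensional k L] (τ : L ≃ₐ[k] L) {r₀ : L} {d : k}
    (hr : r₀ ^ 2 = algebraMap k L d) (hr0 : r₀ ≠ 0) (h2 : (2 : L) ≠ 0) (hτ : τ r₀ = -r₀)
    (y : (W.baseChange L).toAffine.Point) :
    WeierstrassCurve.Affine.Point.map (τ : L →ₐ[k] L)
        (∑ σ : L ≃ₐ[k] L, (if σ r₀ = r₀ then (1 : ℤ) else -1) •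
          WeierstrassCurve.Affine.Point.map (σ : L →ₐ[k] L) y) =
      -∑ σ : L ≃ₐ[k] L, (if σ r₀ = r₀ then (1 : ℤ) else -1) •
          WeierstrassCurve.Affine.Point.map (σ : L →ₐ[k] L) y := by
  rw [map_sum]
  simp_rw [map_zsmul, WeierstrassCurve.Affine.Point.map_map]
  have h : ∀ σ : L ≃ₐ[k] L, ((τ : L →ₐ[k] L).comp (σ : L →ₐ[k] L)) = ((τ * σ : L ≃ₐ[k] L) : L →ₐ[k] L) :=
    fun σ => rfl
  simp_rw [h]
  have hε : ∀ σ : L ≃ₐ[k] L, (if σ r₀ = r₀ then (1 : ℤ) else -1) =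
      -(if (τ * σ) r₀ = r₀ then (1 : ℤ) else -1) := by
    intro σ
    rw [mul_apply_sqrt_eq_iff_of_neg τ σ hr hr0 h2 hτ]
    by_cases hs : σ r₀ = r₀ <;> simp [hs]
  calc ∑ σ : L ≃ₐ[k] L, (if σ r₀ = r₀ then (1 : ℤ) else -1) •
        WeierstrassCurve.Affine.Point.map ((τ * σ : L ≃ₐ[k] L) : L →ₐ[k] L) y
      = ∑ σ : L ≃ₐ[k] L, -((if (τ * σ) r₀ = r₀ then (1 : ℤ) else -1) •
        WeierstrassCurve.Affine.Point.map ((τ * σ : L ≃ₐ[k] L) : L →ₐ[k] L) y) := by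
        refine Finset.sum_congr rfl fun σ _ => ?_
        rw [hε σ, neg_smul]
    _ = -∑ σ : L ≃ₐ[k] L, (if (τ * σ) r₀ = r₀ then (1 : ℤ) else -1) •
        WeierstrassCurve.Affine.Point.map ((τ * σ : L ≃ₐ[k] L) : L →ₐ[k] L) y := by
        rw [Finset.sum_neg_distrib]
    _ = -∑ σ : L ≃ₐ[k] L, (if σ r₀ = r₀ then (1 : ℤ) else -1) •
        WeierstrassCurve.Affine.Point.map (σ : L →ₐ[k] L) y := by
        congr 1
        exact Fintype.sum_equiv (Equiv.mulLeft τ) _ _ fun _ => rfl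

end Equivariance

/-! ## §2 The genus field `H₀ = K(r₀) = K(i₀)`: descent of `P_χ` and anti-invariance under `Gal(H₀/K)` -/

section GenusField

variable {K : Type} [Field K] [NumberField K] {L : Type*} [Field L] [CharZero L] [Algebra K L]
  [FiniteDimensional K L] [IsGalois K L]

/-- **The genus-field data.** For `K` imaginary quadratic with `d_K = −4q` (`q` prime, `(q/7) = −1`), `L/K`
finite Galois, `r₀ ∈ L` with `r₀² = q` and `y₁ ∈ X₀(49)(L)`: with `H₀ = K⟮r₀⟯` (degree `2`) there are
`i₀ ∈ H₀` with `i₀² = −1`, `i₀ ∉ K`, and a point `y_χ ∈ X₀(49)(H₀)` mapping to the twisted sum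
`P_χ = Σ_σ χ(σ)•σy₁` and NEGATED by the non-trivial `K`-automorphism of `H₀` (`Quadratic.conj`, `i₀ ↦ −i₀`):
the conjugation lifts to `τ ∈ Gal(L/K)` (`AlgHom.liftNormal`) with `τ r₀ = −r₀` (`r₀ = −(δ/2)·i₀`,
`δ² = d_K`), and `τ P_χ = −P_χ` (§1). [cite: Gross1984, §§4–5] [cite: CoatesLiTianZhai2015, (2.8)] -/
theorem exists_genusField_data (hK : IsImaginaryQuadratic K) {q : ℕ} (hq : q.Prime)
    (hdK : NumberField.discr K = -(4 * (q : ℤ))) {r₀ : L} (hr : r₀ ^ 2 = algebraMap K L ((q : ℕ) : K))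
    (y₁ : (cm7.baseChange L).toAffine.Point) :
    ∃ (i₀ : K⟮r₀⟯) (hfin : Module.finrank K K⟮r₀⟯ = 2) (hθ : (i₀ : K⟮r₀⟯) ∉ Set.range (algebraMap K K⟮r₀⟯))
      (hi : i₀ ^ 2 = algebraMap K K⟮r₀⟯ (-1)) (yχ : (cm7.baseChange K⟮r₀⟯).toAffine.Point),
      (i₀ : L) ^ 2 = -1 ∧
      Affine.Point.map (algebraMap K⟮r₀⟯ L).toRatAlgHom yχ =
        ∑ σ : L ≃ₐ[K] L, (if σ r₀ = r₀ then (1 : ℤ) else -1) • Affine.Point.map (σ : L →ₐ[K] L) y₁ ∧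
      Affine.Point.map (W' := cm7) (Literature.NumberTheory.QuadraticFields.Quadratic.conj hfin hθ hi) yχ = -yχ := by
  -- arithmetic of the family
  have hqK : ¬ IsSquare ((q : ℕ) : K) := not_isSquare_natCast_of_discr_eq hK hq hdK
  have hfin : Module.finrank K K⟮r₀⟯ = 2 := finrank_adjoin_sqrt_eq_two (L := L) hr hqK
  have hq0 : (q : L) ≠ 0 := by exact_mod_cast hq.ne_zero
  have h2L : (2 : L) ≠ 0 := two_ne_zero
  have hr' : r₀ ^ 2 = (q : L) := by rw [hr, map_natCast]
  have hr0 : r₀ ≠ 0 := by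
    intro h; rw [h, zero_pow two_ne_zero] at hr'; exact hq0 hr'.symm
  -- `δ ∈ K` with `δ² = d_K = −4q`, and `i₀ = δ r₀ / (2q)`
  obtain ⟨δ, hδ, -, -⟩ := exists_sq_eq_discr_and_span hK
  have hδK : δ ^ 2 = -(4 * (q : K)) := by
    rw [hδ, hdK]; simp [map_neg, map_mul, map_ofNat, map_natCast]
  have hδL : (algebraMap K L δ) ^ 2 = -(4 * (q : L)) := by
    rw [← map_pow, hδK]; simp [map_neg, map_mul, map_ofNat, map_natCast]
  have hδ0 : algebraMap K L δ ≠ 0 := by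
    intro h; rw [h, zero_pow two_ne_zero] at hδL
    exact hq0 (by linear_combination hδL / 4)
  obtain ⟨iL, hiL⟩ : ∃ x : L, x = algebraMap K L δ * r₀ / (2 * q) := ⟨_, rfl⟩
  have hiL2 : iL ^ 2 = -1 := by
    rw [hiL, div_pow, mul_pow, hδL, hr']; field_simp; ring
  have hi_mem : iL ∈ K⟮r₀⟯ := by
    rw [hiL]
    refine div_mem (mul_mem (IntermediateField.algebraMap_mem _ δ)
      (IntermediateField.mem_adjoin_simple_self K r₀)) ?_
    exact_mod_cast (natCast_mem K⟮r₀⟯ (2 * q))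
  obtain ⟨i₀, hi₀⟩ : ∃ i : K⟮r₀⟯, i = ⟨iL, hi_mem⟩ := ⟨_, rfl⟩
  have hi₀L : (i₀ : L) = iL := by rw [hi₀]
  have hi : i₀ ^ 2 = algebraMap K K⟮r₀⟯ (-1) := by
    apply Subtype.ext
    simp [hi₀L, hiL2]
  -- `r₀ = b·i₀` with `b = −δ/2 ∈ K`
  obtain ⟨b, hb⟩ : ∃ b : K, b = -(δ / 2) := ⟨_, rfl⟩
  have hr_eq : algebraMap K L b * iL = r₀ := by
    have h4q : (4 : L) * q ≠ 0 := mul_ne_zero (by norm_num) hq0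
    rw [hb, hiL, map_neg, map_div₀, map_ofNat]
    have : -(algebraMap K L δ / 2) * (algebraMap K L δ * r₀ / (2 * q)) =
        -(algebraMap K L δ ^ 2) * r₀ / (4 * q) := by ring
    rw [this, hδL, neg_neg, mul_div_cancel_left₀ r₀ h4q]
  have hθ : (i₀ : K⟮r₀⟯) ∉ Set.range (algebraMap K K⟮r₀⟯) := by
    rintro ⟨κ, hκ⟩
    have hκL : algebraMap K L κ = iL := by
      have := congrArg Subtype.val hκ
      rw [hi₀L] at this
      simpa using this
    apply algebraMap_ne_sqrt_of_not_isSquare hr hqK (b * κ)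
    rw [map_mul, hκL, hr_eq]
  -- the descended twisted sum
  obtain ⟨yχ, hyχ⟩ := exists_map_adjoin_eq_twistedSum cm7 (k := K) hr y₁
  -- the conjugation of `H₀/K` and its lift to `Gal(L/K)`
  haveI : Normal K L := inferInstance
  obtain ⟨τ, hτ⟩ : ∃ τ : L ≃ₐ[K] L, τ = AlgEquiv.ofBijective
      ((Literature.NumberTheory.QuadraticFields.Quadratic.conj hfin hθ hi).liftNormal L)
      (AlgHom.normal_bijective K L L _) := ⟨_, rfl⟩
  have hτcomm : ∀ x : K⟮r₀⟯, τ (algebraMap K⟮r₀⟯ L x) =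
      algebraMap K⟮r₀⟯ L (Literature.NumberTheory.QuadraticFields.Quadratic.conj hfin hθ hi x) := fun x ↦ by
    rw [hτ]; exact (Literature.NumberTheory.QuadraticFields.Quadratic.conj hfin hθ hi).liftNormal_commutes L x
  have hrr : (⟨r₀, IntermediateField.mem_adjoin_simple_self K r₀⟩ : K⟮r₀⟯) =
      algebraMap K K⟮r₀⟯ b * i₀ := by
    apply Subtype.ext
    simp [hi₀L, hr_eq]
  have hτr : τ r₀ = -r₀ := by
    have h1 := hτcomm (algebraMap K K⟮r₀⟯ b * i₀)
    rw [Literature.NumberTheory.QuadraticFields.Quadratic.conj_mul_gen, map_neg, ← hrr] at h1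
    simpa using h1
  refine ⟨i₀, hfin, hθ, hi, yχ, by rw [hi₀L, hiL2], hyχ, ?_⟩
  -- anti-invariance: compare in `X₀(49)(L)`
  apply Affine.Point.map_injective (W' := cm7) (f := (algebraMap K⟮r₀⟯ L).toRatAlgHom)
  have step1 : ∀ P : (cm7.baseChange K⟮r₀⟯).toAffine.Point,
      Affine.Point.map (algebraMap K⟮r₀⟯ L).toRatAlgHom
        (Affine.Point.map (W' := cm7) (Literature.NumberTheory.QuadraticFields.Quadratic.conj hfin hθ hi) P) =
      Affine.Point.map (τ : L →ₐ[K] L) (Affine.Point.map (algebraMap K⟮r₀⟯ L).toRatAlgHom P) := by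
    intro P
    rcases P with _ | ⟨x, y, hxy⟩
    · rfl
    · simp only [Affine.Point.map_some, Affine.Point.some.injEq]
      exact ⟨by simpa using (hτcomm x).symm, by simpa using (hτcomm y).symm⟩
  rw [step1, map_neg, hyχ, map_twistedSum_eq_neg_of_apply_eq_neg cm7 τ hr hr0 h2L hτr y₁]

end GenusField

end Summit.BirchSwinnertonDyer.BirchSwinnertonDyer.Theorems.GoldfeldGoodTwists

end
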